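import Summits.BirchSwinnertonDyer.BirchSwinnertonDyer.Theses.SignedLowerHalves
import Summits.BirchSwinnertonDyer.Rank1Residual.Supersingular.KobayashiMainConjecture
import HarnessLib

/-!
# Route `SignedLowerHalves`, crux `KobayashiLowerHalfSemistable` (item stmt-BirchSwinnertonDyer-19000): the
# registered stubs `stub_five_le`, `stub_three` and the crux BY NAME, each closed MODULO the ONE OPEN binder
# «Burungale–Skinner–Tian–Wan Thm 1.3» (cell `bsd-ssimc`, seat `bsd-ssimc-k3-c2` gen 0, planner row k3-c2 (1);
# a `--supports … --as helper` file, closes nothing)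

PARTITION (cell bsd-ssimc): X6 ∧ r = 0 (A6) × 13 (+10~) cells × p ∈ {3, 5}, X6 ∧ r = 1, literal rows D1/D2 —
types-the-object-of; closes NONE. THEOREMS ONLY. HONEST FRAMING: nothing here is a theorem about any curve;
BSD is not proved by any of this; the crux stays OPEN on the ledger.

The crux (route file `Theses/SignedLowerHalves.lean`, rank 2) is the Eisenstein (lower) half of Kobayashi's
signed main conjecture for ONE sign on corner X6 (semistable `E`, odd good supersingular `p`, `p ≥ 5 ∨ a_3 = 0`):
`∃ ε, KobayashiLowerDivisibility W p ε`. Its only engine in print is the PREPRINT arXiv:2409.01350v2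
(Burungale–Skinner–Tian–Wan), Thm 1.3 = Part II Thm 1.18, transcribed in the tree as the OPEN binder
`Summit.BirchSwinnertonDyer.Rank1Residual.Supersingular.BurungaleSkinnerTianWan2024_thm13_OPEN`
(`Supersingular/KobayashiMainConjecture.lean`; `[claim: …, under-review]`, NEVER a theorem): for semistable
`E`, supersingular `p > 2` with `a_3 = 0` if `p = 3`, the FULL equality `KobayashiMainConjecture W p ε` for
EVERY sign. The class condition `ClassX6 W p = GoodSS W p ∧ Semistable W ∧ (5 ≤ p ∨ a_3 = 0)` supplies the
binder's hypotheses verbatim (`BurungaleSkinnerTianWan2024.h4_of_classX6` for the `p = 3` proviso), and the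
equality gives the lower half with `h = 1` (`kobayashiLowerDivisibility_of_mainConjecture`). So the two
registered stubs of the BC3 skeleton `Cruxes/KobayashiLowerHalfSemistable/Lines/birth.lean`
(`stub_five_le`: `p ≥ 5`; `stub_three`: `p = 3`) and the crux itself are each ONE line from the binder —
the exact twin of `stub_fwLocus_of_thm51_OPEN` (item 19001, p414676). The statements below are the
registered stub headers VERBATIM with ONE extra leading binder, and the crux's fully-qualified name.

What the binder hides (cell verification of record, for the reader; not used by the kernel): REPORT-bstw-6
(7a95ba616d84dc36) = Thm 1.3 at `p ≥ 5` PASS-with-cell-repairs, G-ledger EMPTY, residue (A-γ), c^δ,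
q₀ = 2, SCOPE RIDER (α) «covered iff an S2-auxiliary imaginary quadratic `L` with `p ∤ h_L` exists»
(NOTE-W-ref-2); REPORT-bstw-7 (40fdbe7e627732c4) = at `p = 3` BSTW's own clause rests on the preprint
[SV-S-Ohta], ONE located residual (3-ii)♭. Nothing is booked; the sign chosen below is `ε = 1` (either works).

References: [BurungaleSkinnerTianWan2024] Thm 1.3 / II Thm 1.18 (PRE); [Kobayashi2003] Conjecture (p. 2),
Thm 1.2, §4 (p. 8).
-/

set_option autoImplicit false
set_option linter.dupNamespace false

noncomputable section

open scoped Classical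

open WeierstrassCurve Literature.NumberTheory.EllipticCurves
  Literature.NumberTheory.EllipticCurves.Rank1Residual
  Summit.BirchSwinnertonDyer.Rank1Residual.Supersingular

namespace Summit.BirchSwinnertonDyer.BirchSwinnertonDyer.Theorems

/-- **Every sign, MODULO the OPEN binder.** IF `BurungaleSkinnerTianWan2024_thm13_OPEN` holds (`hBSTW`,
UNREFEREED), then on corner X6 at an odd prime the Eisenstein half `KobayashiLowerDivisibility W p ε` holds
for EVERY sign `ε` (indeed the full equality): `ClassX6` gives `Semistable W`, `GoodSS W p` and the
`p = 3 → a_3 = 0` proviso (`h4_of_classX6`). CONDITIONAL; closes nothing.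
[claim: BurungaleSkinnerTianWan2024, status: under-review]
[cite: Kobayashi2003, Conjecture (Main Conjecture) (p. 2)] -/
theorem X6_kobayashiLowerDivisibility_of_thm13_OPEN (hBSTW : BurungaleSkinnerTianWan2024_thm13_OPEN)
    (W : WeierstrassCurve ℚ) [W.IsElliptic] [W.IsGloballyMinimal] (p : ℕ) [Fact p.Prime]
    (hp : p ≠ 2) (hX : ClassX6 W p) (ε : ℤˣ) :
    Summit.BirchSwinnertonDyer.Rank1Residual.Supersingular.KobayashiLowerDivisibility W p ε :=
  kobayashiLowerDivisibility_of_mainConjecture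
    (hBSTW W p hp hX.2.1 hX.1 (BurungaleSkinnerTianWan2024.h4_of_classX6 W p hX) ε)

/-- **`stub_five_le` (verbatim header) MODULO the OPEN binder «BSTW Thm 1.3».** For every globally minimal
`W/ℚ` and prime `p ≠ 2` with `ClassX6 W p` and `5 ≤ p`: IF `BurungaleSkinnerTianWan2024_thm13_OPEN` holds
(`hBSTW`, UNREFEREED; cell reading of record at `p ≥ 5`: PASS-with-cell-repairs scoped by the (α) rider),
then `∃ ε, KobayashiLowerDivisibility W p ε` (witness `ε = 1`). The binder `5 ≤ p` is carried unused (the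
OPEN claim covers `p = 3` too). CONDITIONAL; closes nothing. [claim: BurungaleSkinnerTianWan2024, status: under-review]
[cite: Kobayashi2003, Conjecture (Main Conjecture) (p. 2)] -/
theorem stub_five_le_of_thm13_OPEN (hBSTW : BurungaleSkinnerTianWan2024_thm13_OPEN) :
    ∀ (W : WeierstrassCurve ℚ) [W.IsElliptic] [W.IsGloballyMinimal] (p : ℕ) [Fact p.Prime],
      p ≠ 2 → Literature.NumberTheory.EllipticCurves.Rank1Residual.ClassX6 W p → 5 ≤ p →
      ∃ ε : ℤˣ, Summit.BirchSwinnertonDyer.Rank1Residual.Supersingular.KobayashiLowerDivisibility W p ε := by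
  intro W _ _ p _ hp hX _h5
  exact ⟨1, X6_kobayashiLowerDivisibility_of_thm13_OPEN hBSTW W p hp hX 1⟩

/-- **`stub_three` (verbatim header) MODULO the OPEN binder «BSTW Thm 1.3».** For every globally minimal
`W/ℚ` with `ClassX6 W 3` (so `a_3 = 0`): IF `BurungaleSkinnerTianWan2024_thm13_OPEN` holds (`hBSTW`,
UNREFEREED; cell reading of record at `p = 3`: BSTW's own clause rests on the preprint [SV-S-Ohta], located
residual (3-ii)♭, REPORT-bstw-7), then `∃ ε, KobayashiLowerDivisibility W 3 ε` (witness `ε = 1`).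
CONDITIONAL; closes nothing. [claim: BurungaleSkinnerTianWan2024, status: under-review]
[cite: Kobayashi2003, Conjecture (Main Conjecture) (p. 2)] -/
theorem stub_three_of_thm13_OPEN (hBSTW : BurungaleSkinnerTianWan2024_thm13_OPEN) :
    ∀ (W : WeierstrassCurve ℚ) [W.IsElliptic] [W.IsGloballyMinimal],
      Literature.NumberTheory.EllipticCurves.Rank1Residual.ClassX6 W 3 →
      ∃ ε : ℤˣ, Summit.BirchSwinnertonDyer.Rank1Residual.Supersingular.KobayashiLowerDivisibility W 3 ε := by
  intro W _ _ hX
  haveI : Fact (Nat.Prime 3) := ⟨Nat.prime_three⟩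
  exact ⟨1, X6_kobayashiLowerDivisibility_of_thm13_OPEN hBSTW W 3 (by decide) hX 1⟩

/-- **The crux BY NAME, MODULO the OPEN binder «BSTW Thm 1.3».** IF `BurungaleSkinnerTianWan2024_thm13_OPEN`
holds (`hBSTW`, UNREFEREED), then the route item
`Summit.BirchSwinnertonDyer.BirchSwinnertonDyer.Theses.SignedLowerHalves.KobayashiLowerHalfSemistable` holds.
This is the honest Lean reading of «crux 2 = BSTW Thm 1.3's lower half on X6»: the item is CLOSED MODULO exactly
this one named PRE claim and nothing else. CONDITIONAL (`conditional-result`); the item stays OPEN.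
[claim: BurungaleSkinnerTianWan2024, status: under-review] [cite: Kobayashi2003, Conjecture (Main Conjecture) (p. 2)] -/
theorem KobayashiLowerHalfSemistable_of_thm13_OPEN (hBSTW : BurungaleSkinnerTianWan2024_thm13_OPEN) :
    Summit.BirchSwinnertonDyer.BirchSwinnertonDyer.Theses.SignedLowerHalves.KobayashiLowerHalfSemistable := by
  intro W _ _ p _ hp hX
  exact ⟨1, X6_kobayashiLowerDivisibility_of_thm13_OPEN hBSTW W p hp hX 1⟩

end Summit.BirchSwinnertonDyer.BirchSwinnertonDyer.Theorems

end
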